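import Summits.QuantumFields.YangMills.Theorems.BalabanUVNodesN15DefectKernelCov
import Literature.MathematicalPhysics.QuantumFieldTheory.King1986.MinimizerTwoSpacingDecay
import HarnessLib

/-!
# Route «BalabanUVNodes» (K4 «SpineRates»), node N15 = NE2, THE -a ∕ -b INTERFACE OF THE BACKGROUND LAYER, part 7: THE SINGLE-SCALE PIECE ON BAŁABAN'S
# VOLUMES WITH THEOREM 3.3 BY NAME — the minimiser's decay binders of parts 5–6 DISCHARGED from n18-b's tower bridge under a distance dominance

Cell `pub-ymgap`, seat `pub-ymgap-dag-n15-a` (KNIT-BY-NAME, generation g2; HUMAN RULING D-0062; chair R424 venue; `bears_on: R4∕N15`).  Filed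
`--supports stmt-QuantumFields-19351` until the node stub `S_N15` of route «BalabanUVNodes» is an item.  THEOREMS ONLY; imports BY NAME, nothing
in the tree modified: part 6 `BalabanUVNodesN15DefectKernelCov` (this seat: `hasMaj_idef_kingPiece_covFree`), seat n18-b's `King1986.MinimizerTwoSpacingDecay`
(`minimiser_kernel_decay_labels` = King's Theorem 3.3 for the ACTUAL minimiser, UNCONDITIONAL on Bałaban's volumes, from `King1986.MinimizerTowerBridge`
⇐ lit-balaban's `B4Thm110ZeroTorus.thm110_zero_torus` = [Balaban1983RegularityDecay] (1.10); `sitesPerDir_finerVolume`), `King1986.MinimizerTowerBridge`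
(`sitesPerDir_zero_eq_fine`), `King1986.EffectiveLaplacianRate` (`aK_le`), the tower `Balaban1983to89.Setup` (`Params`, `Site`, `Params.eps_pos`),
`B1RG242Torus` (`Site.proj`), `B5Ineq137Torus.T` (the tower's sup torus distance).

WHY (dag-ref-B READ #72 pin (i), READ #87).  Parts 5–6 proved King's (4.42)–(4.43) single-scale piece in binder (a)'s format modulo Theorem 3.3's decay of
the two minimiser kernels, typed as binders in the CARRIER's distance `g.dist`.  That decay IS a tree theorem, but in the TOWER's vocabulary: for every volume
`P = (d, L, m, K)` (unit torus `M_μ = 2L^m`), `|ℋ_K(x,b)| ≤ a_K·c₀·e^{−δ₀·εD}` whenever `D ≤ T(x,z)` for every fine point `z` of the block of `b`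
(`minimiser_kernel_decay_labels`).  THIS FILE builds the bridge the referee named: under a DOMINANCE of the carrier's distance by the tower's physical
distance to the block, `κ·d(blk_Ω b, blk_η x) ≤ ε·T(x,z)` (`z` in the block of `b`; a binder of the same kind as part 3's `hdom`, the consumer's reading of its
site assignments), the decay binders `hdecH`∕`hdecH′` of part 6 FOLLOW with `c₀ ↦ a·c₀`, `δ₀ ↦ δ₀·κ`; hence King's single-scale piece on Bałaban's
volumes with EVERY analytic input by name — Prop. 3.8 (3.71) (n18-b), Lemma 4.5 (4.38) and (4.33)–(4.34) (template lineage), Theorem 3.3 (lit-balaban's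
[Ba 4] (1.10) through n18-b's bridge) — and only GEOMETRIC binders left (carrier (2.54)∕symmetry∕(2.61), site assignments and their block counts, King's
pairing, the two distance dominances, the rate window).

CONTENTS.
* §1 LABEL TRANSFER: every King-side point has a tower twin with the same labels (`exists_site_labels`, `exists_unitSite_labels`; the finer volume
  `(d, L, m, K + n)` has the same unit torus, `sitesPerDir_finerVolume`).
* §2 **`minimiser_decay_of_dominance`**: `∃ δ₀ c₀ > 0` (d, L, a, m² only) such that on every volume, under the dominance `κ·d ≤ ε·T` (`κ > 0`),
  `|ℋ_K(δ_b)(x)| ≤ a·c₀·e^{−δ₀κ·d(blk_Ω b, blk_η x)}` for ALL King-side `b`, `x` — part 6's binder `hdecH` — AND the same for `ℋ_{K+n}` on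
  `Tor (fine (L^nL^K) M)` read through King's pairing `pr` (binder `hdecH′`), from the finer volume `(d, L, m, K + n)` over the same unit torus.
* §3 **`hasMaj_idef_kingPiece_tower`**: `∃ δ₀ c₀ > 0` such that for every volume `P` (`K ≥ 1`), `n ≥ 1`, the unit torus `M_μ = 2L^m` of `P`, King's
  actual `ℋ`, `C`, `Q G` (binders `hH`, `hH′`, `hK`, `hK′`, pairing `hpr`), any [B6] carrier and site assignments with the two dominances and the rate
  window `ρ + σ_r ≤ δ₀κ∕2`, `ρ + σ_r ≤ δ_C`: part 6's block majorant with `c₀ ↦ a·c₀`, `δ₀ ↦ δ₀κ`.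

HONEST FRAMING ∕ LIMITS.  King's scalar `A = 0` MODEL (template literature) of binder (a) for ONE single-scale piece, now by name in all analytic inputs
on Bałaban's volumes (odd `L ≥ 3`, `m² > 0`, periodic b.c.); the geometric binders are the consumer's; the `γ∕2` exponent of the minimiser legs
(part 5 header) and the un-redone telescoping∕`j = 0`∕prefactor bookkeeping stand; NOT Bałaban's covariant objects (the -a VECTOR instance needs
(1.63)'s two-lattice rate, NOT in the tree); NE2⁺ NOT PRINTED ∕ not proved; count-neutral (typed 28∕28 · discharged unchanged); NOT a discharge of
N15; one finite T⁴ at fixed ε — NOT infinite volume, NOT OS on ℝ⁴, NOT a mass gap, NOT Clay.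
-/

noncomputable section

namespace Summit.QuantumFields.YangMills.BalabanUVNodes.N15.DefectKernel

open Literature.MathematicalPhysics.QuantumFieldTheory.Balaban1983to89
open Literature.MathematicalPhysics.QuantumFieldTheory.Balaban1983to89.B11SectG (BlockNorm HasMaj RowSum)
open Literature.MathematicalPhysics.QuantumFieldTheory.Balaban1983to89.T4EtaRateDefect (idef)
open Literature.MathematicalPhysics.QuantumFieldTheory.Balaban1983to89.T4EtaRateCoeffDefect (pull fibre)
open Literature.MathematicalPhysics.QuantumFieldTheory.Balaban1983to89.B6RandomWalk (Triangle254)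
open Literature.MathematicalPhysics.QuantumFieldTheory.Balaban1983to89.B5Prop11Plancherel (Tor fine)
open Literature.MathematicalPhysics.QuantumFieldTheory.King1986 (aK aK_le prop38RateConst prop38PosConst lemma43Const)
open Literature.MathematicalPhysics.QuantumFieldTheory.King1986.Torus (minimiser effLaplacian blockProj tdistT K45 delta45 gam0L
  minimiser_kernel_decay_labels sitesPerDir_finerVolume sitesPerDir_zero_eq_fine)

/-! ## §1 Label transfer: King-side points have tower twins -/

section Labels

/-- A King-side fine point `xt ∈ Tor (fine N M)` (`N = L^K`, `M_μ = 2L^m` the unit torus of the volume `P`) has a tower twin `x ∈ T_ε` with the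
same labels. [cite: Balaban1987RG1, (0.1) p.251 (the tori)] -/
theorem exists_site_labels (P : Params) (M : Fin P.d → ℕ) [∀ μ, NeZero (M μ)] (hMK : ∀ μ, M μ = P.sitesPerDir P.K)
    (N : ℕ) [NeZero N] (hN : N = P.L ^ P.K) (xt : Tor (fine N M)) :
    ∃ x : Literature.MathematicalPhysics.QuantumFieldTheory.Balaban1983to89.Site P 0, ∀ μ, (xt μ).val = (x μ).val := by
  refine ⟨fun μ => (((xt μ).val : ℕ) : ZMod (P.sitesPerDir 0)), fun μ => ?_⟩
  have hlt : (xt μ).val < P.sitesPerDir 0 := by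
    rw [sitesPerDir_zero_eq_fine P M hMK μ, ← hN]
    exact ZMod.val_lt (xt μ)
  show (xt μ).val = ((((xt μ).val : ℕ) : ZMod (P.sitesPerDir 0))).val
  rw [ZMod.val_natCast, Nat.mod_eq_of_lt hlt]

/-- A King-side unit point `bt ∈ Tor M` has a tower twin `b ∈ T^{(K)}` with the same labels. [cite: Balaban1987RG1, (0.1) p.251] -/
theorem exists_unitSite_labels (P : Params) (M : Fin P.d → ℕ) [∀ μ, NeZero (M μ)] (hMK : ∀ μ, M μ = P.sitesPerDir P.K)
    (bt : Tor M) :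
    ∃ b : Literature.MathematicalPhysics.QuantumFieldTheory.Balaban1983to89.Site P P.K, ∀ μ, (bt μ).val = (b μ).val := by
  refine ⟨fun μ => (((bt μ).val : ℕ) : ZMod (P.sitesPerDir P.K)), fun μ => ?_⟩
  have hlt : (bt μ).val < P.sitesPerDir P.K := by rw [← hMK μ]; exact ZMod.val_lt (bt μ)
  show (bt μ).val = ((((bt μ).val : ℕ) : ZMod (P.sitesPerDir P.K))).val
  rw [ZMod.val_natCast, Nat.mod_eq_of_lt hlt]

end Labels

/-! ## §2 The minimiser's Theorem 3.3 in the carrier's distance, from the tower decay under a dominance -/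

section Decay

open Literature.MathematicalPhysics.QuantumFieldTheory.Balaban1983to89.B5Ineq137Torus (T)

/-- **THEOREM 3.3 FOR KING'S MINIMISER IN THE CARRIER'S DISTANCE** (both runs at once).  There are `δ₀, c₀ > 0` (functions of `d, L, a, m²`) such that for
every volume `P = (d, L, m, K)` with `K ≥ 1`, every `n`, the unit torus `M_μ = 2L^m`, any [B6] carrier with site assignments `blkΩ` of the unit torus
and `blkη` of `T_η = Tor (fine L^K M)`, any map `pr` from `T_{η′} = Tor (fine (L^nL^K) M)`, and any `κ > 0` DOMINATED BY THE TOWER'S DISTANCE TO THE BLOCK —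
`κ·d(blkΩ bt, blkη xt) ≤ ε·T(x, z)` for all tower twins `x` of `xt` and all `z` in the block of the twin of `bt`, and likewise at the finer volume for
`blkη (pr xt′)` — King's ACTUAL minimiser kernels satisfy `|ℋ_K(δ_bt)(xt)| ≤ a·c₀·e^{−δ₀κ·d(blkΩ bt, blkη xt)}` and
`|ℋ_{K+n}(δ_bt)(xt′)| ≤ a·c₀·e^{−δ₀κ·d(blkΩ bt, blkη(pr xt′))}` — part 6's binders `hdecH`, `hdecH′`. [cite: King1986, Theorem 3.3 p.658; Balaban1983RegularityDecay, Theorem (1.10) p.573] -/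
theorem minimiser_decay_of_dominance (dd L : ℕ) (hd : 1 ≤ dd) (hL : Odd L ∧ 1 < L) {a m2 : ℝ} (ha : 0 < a) (hm : 0 < m2) :
    ∃ δ₀ c₀ : ℝ, 0 < δ₀ ∧ 0 < c₀ ∧ ∀ (P : Params) (_ : P.d = dd) (_ : P.L = L) (_ : 1 ≤ P.K) [NeZero P.L] (n : ℕ)
      (M : Fin P.d → ℕ) [∀ μ, NeZero (M μ)] (hMK : ∀ μ, M μ = P.sitesPerDir P.K)
      {g : B6.Geometry} (blkΩ : Tor M → g.Site) (blkη : Tor (fine (P.L ^ P.K) M) → g.Site)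
      (pr : Tor (fine (P.L ^ n * P.L ^ P.K) M) → Tor (fine (P.L ^ P.K) M)) (hdist : ∀ y y' : g.Site, 0 ≤ g.dist y y')
      {κ : ℝ} (_ : 0 < κ)
      (_ : ∀ (bt : Tor M) (xt : Tor (fine (P.L ^ P.K) M)) (x z : Site P 0) (b : Site P P.K),
        (∀ μ, (xt μ).val = (x μ).val) → (∀ μ, (bt μ).val = (b μ).val) → Site.proj P.K P.K z = b →
        κ * g.dist (blkΩ bt) (blkη xt) ≤ P.eps * T P 0 x z)
      (_ : ∀ (bt : Tor M) (xt' : Tor (fine (P.L ^ n * P.L ^ P.K) M))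
        (x' z' : Site (⟨P.d, P.L, P.m, P.K + n, P.hd, P.hL⟩ : Params) 0)
        (b' : Site (⟨P.d, P.L, P.m, P.K + n, P.hd, P.hL⟩ : Params) (P.K + n)),
        (∀ μ, (xt' μ).val = (x' μ).val) → (∀ μ, (bt μ).val = (b' μ).val) → Site.proj (P.K + n) (P.K + n) z' = b' →
        κ * g.dist (blkΩ bt) (blkη (pr xt')) ≤
          (⟨P.d, P.L, P.m, P.K + n, P.hd, P.hL⟩ : Params).eps * T (⟨P.d, P.L, P.m, P.K + n, P.hd, P.hL⟩ : Params) 0 x' z'),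
      (∀ (bt : Tor M) (xt : Tor (fine (P.L ^ P.K) M)),
        |minimiser (P.L ^ P.K) M (aK a P.L P.K) (((P.L ^ P.K : ℕ) : ℝ) ^ 2) m2 (Pi.single bt 1) xt|
          ≤ a * c₀ * Real.exp (-(δ₀ * κ * g.dist (blkΩ bt) (blkη xt)))) ∧
      (1 ≤ n → ∀ (bt : Tor M) (xt' : Tor (fine (P.L ^ n * P.L ^ P.K) M)),
        |minimiser (P.L ^ n * P.L ^ P.K) M (aK a P.L (P.K + n)) (((P.L ^ n * P.L ^ P.K : ℕ) : ℝ) ^ 2) m2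
            (Pi.single bt 1) xt'|
          ≤ a * c₀ * Real.exp (-(δ₀ * κ * g.dist (blkΩ bt) (blkη (pr xt'))))) := by
  obtain ⟨δ₀, c₀, hδ₀, hc₀, H⟩ := minimiser_kernel_decay_labels dd L hd hL ha hm.le
  refine ⟨δ₀, c₀, hδ₀, hc₀, ?_⟩
  intro P hPd hPL hK _ n M _ hMK g blkΩ blkη pr hdist κ hκ hdomA hdomB
  have hLr : (1 : ℝ) < P.L := by exact_mod_cast P.hL.2
  constructor
  · -- run A: the volume `P`
    intro bt xt
    have hεA : 0 < P.eps := Params.eps_pos P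
    obtain ⟨x, hx⟩ := exists_site_labels P M hMK (P.L ^ P.K) rfl xt
    obtain ⟨b, hb⟩ := exists_unitSite_labels P M hMK bt
    set D : ℝ := κ * g.dist (blkΩ bt) (blkη xt) / P.eps with hD
    have hD0 : 0 ≤ D := div_nonneg (mul_nonneg hκ.le (hdist _ _)) hεA.le
    have hDle : ∀ z : Site P 0, Site.proj P.K P.K z = b → D ≤ T P 0 x z := fun z hz => by
      rw [hD, div_le_iff₀ hεA, mul_comm _ P.eps]
      exact hdomA bt xt x z b hx hb hz
    have hA := H P hPd hPL hK M hMK (P.L ^ P.K) rfl xt x hx bt b hb D hD0 hDle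
    have hεD : P.eps * D = κ * g.dist (blkΩ bt) (blkη xt) := by rw [hD]; field_simp
    rw [hεD, ← mul_assoc] at hA
    exact hA.trans (mul_le_mul_of_nonneg_right (mul_le_mul_of_nonneg_right (aK_le ha hLr hK) hc₀.le)
      (Real.exp_pos _).le)
  · -- run B: the finer volume `(d, L, m, K + n)` over the same unit torus
    intro hn bt xt'
    have hεB : 0 < ((⟨P.d, P.L, P.m, P.K + n, P.hd, P.hL⟩ : Params)).eps := Params.eps_pos _
    have hMK' : ∀ μ, M μ = (⟨P.d, P.L, P.m, P.K + n, P.hd, P.hL⟩ : Params).sitesPerDir (P.K + n) := fun μ => by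
      rw [hMK μ]; exact (sitesPerDir_finerVolume P n).symm
    have hN : P.L ^ n * P.L ^ P.K = P.L ^ (P.K + n) := by rw [pow_add, mul_comm]
    obtain ⟨x', hx'⟩ := exists_site_labels (⟨P.d, P.L, P.m, P.K + n, P.hd, P.hL⟩ : Params) M hMK'
      (P.L ^ n * P.L ^ P.K) hN xt'
    obtain ⟨b', hb'⟩ := exists_unitSite_labels (⟨P.d, P.L, P.m, P.K + n, P.hd, P.hL⟩ : Params) M hMK' bt
    set D : ℝ := κ * g.dist (blkΩ bt) (blkη (pr xt')) / ((⟨P.d, P.L, P.m, P.K + n, P.hd, P.hL⟩ : Params)).eps with hD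
    have hD0 : 0 ≤ D := div_nonneg (mul_nonneg hκ.le (hdist _ _)) hεB.le
    have hDle : ∀ z' : Site (⟨P.d, P.L, P.m, P.K + n, P.hd, P.hL⟩ : Params) 0,
        Site.proj (P.K + n) (P.K + n) z' = b' →
        D ≤ T (⟨P.d, P.L, P.m, P.K + n, P.hd, P.hL⟩ : Params) 0 x' z' := fun z' hz' => by
      rw [hD, div_le_iff₀ hεB, mul_comm _ ((⟨P.d, P.L, P.m, P.K + n, P.hd, P.hL⟩ : Params)).eps]
      exact hdomB bt xt' x' z' b' hx' hb' hz'
    have hB := H (⟨P.d, P.L, P.m, P.K + n, P.hd, P.hL⟩ : Params) hPd hPL (show 1 ≤ P.K + n by omega) M hMK'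
      (P.L ^ n * P.L ^ P.K) hN xt' x' hx' bt b' hb' D hD0 hDle
    have hεD : ((⟨P.d, P.L, P.m, P.K + n, P.hd, P.hL⟩ : Params)).eps * D = κ * g.dist (blkΩ bt) (blkη (pr xt')) := by
      rw [hD]; field_simp
    rw [hεD, ← mul_assoc] at hB
    exact hB.trans (mul_le_mul_of_nonneg_right (mul_le_mul_of_nonneg_right
      (aK_le ha hLr (show 1 ≤ P.K + n by omega)) hc₀.le) (Real.exp_pos _).le)

end Decay

/-! ## §3 The single-scale piece on Bałaban's volumes, every analytic input by name -/

section Piece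

open Literature.MathematicalPhysics.QuantumFieldTheory.Balaban1983to89.B5Ineq137Torus (T)

/-- **KING'S SINGLE-SCALE PIECE (4.42) IN BINDER (a)'s FORMAT ON BAŁABAN'S VOLUMES — Prop. 3.8, Lemma 4.5, (4.33)–(4.34) AND Theorem 3.3 BY NAME.**
There are `δ₀, c₀ > 0` (functions of `d, L, a, m²`; from [Ba 4] (1.10) through n18-b's bridge) such that for every volume `P = (d, L, m, K)` (`K ≥ 1`, odd `L ≥ 3`,
the unit torus `M_μ = 2L^m`), every `n ≥ 1`, King's actual `ℋ_K`, `ℋ_{K+n}` (binders `hH`, `hH′`), their Riemann-weighted transposes (`hK`, `hK′`, `w ≥ 0`),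
the covariances `C^{(K)}`, `C^{(K+n)}` (explicit), King's pairing `pr` (`hpr`), any [B6] carrier ((2.54), `d ≥ 0`, symmetry, (2.61) at `σ_r`), any site
assignments (block counts `nΩ`, `n_η`; fine points in the cube of their coarse point), the C-dominance `δ_C·d ≤ δ₄₅·tdist` and the MINIMISER dominance
`κ·d ≤ ε·T` to the block (both volumes), and a rate `ρ ≥ 0` with `ρ + σ_r ≤ δ₀κ∕2`, `ρ + σ_r ≤ δ_C`: `𝔇(ℋ′C′K′, ℋCK)` through (pull, pull) has part 6's block
majorant with `c₀ ↦ a·c₀`, i.e. `[nΩ(ac₀)c_r(m₀ε_K + nΩR_Cc_r·a_K) + nΩR_Hc_r·m₀·a_K]·e^{−ρd}`, `m₀ = nΩ(2∕γ₀)c_r`, `ε_K = n_ηwR_H`, `a_K = n_ηw(ac₀)`,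
`R_H = √((C₁+C₂)L^{−γK}·2ac₀)`, `R_C = K₄₅L^{−K}`. [cite: King1986, (4.42)–(4.43) p.675; Prop. 3.8 (3.71) p.664; Lemma 4.5 (4.38), (4.33)–(4.34) p.674, Theorem 3.3 p.658; Balaban1983RegularityDecay, (1.10) p.573] -/
theorem hasMaj_idef_kingPiece_tower (dd L : ℕ) (hd : 1 ≤ dd) (hL : Odd L ∧ 1 < L) {a m2 : ℝ} (ha : 0 < a) (hm : 0 < m2)
    {γ : ℝ} (hγ0 : 0 ≤ γ) (hγ1 : γ ≤ 1) :
    ∃ δ₀ c₀ : ℝ, 0 < δ₀ ∧ 0 < c₀ ∧ ∀ (P : Params) (_ : P.d = dd) (_ : P.L = L) (_ : 1 ≤ P.K) [NeZero P.L]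
      (n : ℕ) (_ : 1 ≤ n) (M : Fin P.d → ℕ) [∀ μ, NeZero (M μ)] (_ : ∀ μ, fine P.L M μ = P.sitesPerDir P.K)
      -- the carrier and the site assignments
      {g : B6.Geometry} [DecidableEq g.Site] (_ : Triangle254 g) (_ : ∀ y y' : g.Site, 0 ≤ g.dist y y')
      (_ : ∀ y y' : g.Site, g.dist y y' = g.dist y' y) {σr cr : ℝ} (_ : 0 ≤ σr) (_ : RowSum g σr cr)
      (blkΩ : Tor (fine P.L M) → g.Site) {nΩ : ℕ} (_ : ∀ y', (fibre blkΩ y').card ≤ nΩ)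
      (blkη : Tor (fine (P.L ^ P.K) (fine P.L M)) → g.Site) {nη : ℕ} (_ : ∀ y', (fibre blkη y').card ≤ nη)
      (pr : Tor (fine (P.L ^ n * P.L ^ P.K) (fine P.L M)) → Tor (fine (P.L ^ P.K) (fine P.L M)))
      (_ : ∀ x' μ, (pr x' μ).val = (x' μ).val / P.L ^ n)
      -- King's actual operators, read off as linear maps
      (H : (Tor (fine P.L M) → ℝ) →ₗ[ℝ] (Tor (fine (P.L ^ P.K) (fine P.L M)) → ℝ))
      (_ : ∀ φ, H φ = minimiser (P.L ^ P.K) (fine P.L M) (aK a P.L P.K) (((P.L ^ P.K : ℕ) : ℝ) ^ 2) m2 φ)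
      (H' : (Tor (fine P.L M) → ℝ) →ₗ[ℝ] (Tor (fine (P.L ^ n * P.L ^ P.K) (fine P.L M)) → ℝ))
      (_ : ∀ φ, H' φ = minimiser (P.L ^ n * P.L ^ P.K) (fine P.L M) (aK a P.L (P.K + n))
        (((P.L ^ n * P.L ^ P.K : ℕ) : ℝ) ^ 2) m2 φ)
      {w : ℝ} (_ : 0 ≤ w) (K : (Tor (fine (P.L ^ P.K) (fine P.L M)) → ℝ) →ₗ[ℝ] (Tor (fine P.L M) → ℝ))
      (_ : ∀ x b, K (Pi.single x 1) b = w * H (Pi.single b 1) x)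
      (K' : (Tor (fine (P.L ^ n * P.L ^ P.K) (fine P.L M)) → ℝ) →ₗ[ℝ] (Tor (fine P.L M) → ℝ))
      (_ : ∀ x' b, K' (Pi.single x' 1) b = w / ((P.L : ℝ) ^ n) ^ P.d * H' (Pi.single b 1) x')
      -- the two distance dominances (the consumer's reading of its site assignments)
      {δC : ℝ} (_ : ∀ x z, δC * g.dist (blkΩ x) (blkΩ z) ≤ delta45 P.d a P.L * tdistT (fine P.L M) x z)
      {κ : ℝ} (_ : 0 < κ)
      (_ : ∀ (bt : Tor (fine P.L M)) (xt : Tor (fine (P.L ^ P.K) (fine P.L M))) (x z : Site P 0) (b : Site P P.K),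
        (∀ μ, (xt μ).val = (x μ).val) → (∀ μ, (bt μ).val = (b μ).val) → Site.proj P.K P.K z = b →
        κ * g.dist (blkΩ bt) (blkη xt) ≤ P.eps * T P 0 x z)
      (_ : ∀ (bt : Tor (fine P.L M)) (xt' : Tor (fine (P.L ^ n * P.L ^ P.K) (fine P.L M)))
        (x' z' : Site (⟨P.d, P.L, P.m, P.K + n, P.hd, P.hL⟩ : Params) 0)
        (b' : Site (⟨P.d, P.L, P.m, P.K + n, P.hd, P.hL⟩ : Params) (P.K + n)),
        (∀ μ, (xt' μ).val = (x' μ).val) → (∀ μ, (bt μ).val = (b' μ).val) → Site.proj (P.K + n) (P.K + n) z' = b' →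
        κ * g.dist (blkΩ bt) (blkη (pr xt')) ≤
          (⟨P.d, P.L, P.m, P.K + n, P.hd, P.hL⟩ : Params).eps * T (⟨P.d, P.L, P.m, P.K + n, P.hd, P.hL⟩ : Params) 0 x' z')
      -- the rate window
      {ρ : ℝ} (_ : 0 ≤ ρ) (_ : ρ + σr ≤ δ₀ * κ / 2) (_ : ρ + σr ≤ δC),
      HasMaj (BlockNorm.ofBlocks g blkη) (BlockNorm.ofBlocks g (blkη ∘ pr))
        (idef (pull pr) (pull pr)
          (H' ∘ₗ (Matrix.mulVecLin (effLaplacian (P.L ^ n * P.L ^ P.K) (fine P.L M) (aK a P.L (P.K + n))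
              (((P.L ^ n * P.L ^ P.K : ℕ) : ℝ) ^ 2) m2 + (a * ((P.L : ℝ) ^ 2)⁻¹) • blockProj P.L M)⁻¹ ∘ₗ K'))
          (H ∘ₗ (Matrix.mulVecLin (effLaplacian (P.L ^ P.K) (fine P.L M) (aK a P.L P.K) (((P.L ^ P.K : ℕ) : ℝ) ^ 2) m2
              + (a * ((P.L : ℝ) ^ 2)⁻¹) • blockProj P.L M)⁻¹ ∘ₗ K)))
        (fun y y' =>
          (nΩ * (a * c₀) * cr *
              (nΩ * (2 / gam0L P.d a P.L) * cr *
                  (nη * w * Real.sqrt ((prop38RateConst a a (lemma43Const a P.L P.K n) ((Real.pi ^ 2 / 4) ^ P.d) P.d γ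
                    + prop38PosConst a ((Real.pi ^ 2 / 4) ^ P.d) P.d γ) * ((P.L ^ P.K : ℕ) : ℝ) ^ (-γ) * (2 * (a * c₀))))
                + nΩ * (K45 P.d a P.L * ((P.L : ℝ) ^ P.K)⁻¹) * cr * (nη * w * (a * c₀)))
            + nΩ * Real.sqrt ((prop38RateConst a a (lemma43Const a P.L P.K n) ((Real.pi ^ 2 / 4) ^ P.d) P.d γ
                  + prop38PosConst a ((Real.pi ^ 2 / 4) ^ P.d) P.d γ) * ((P.L ^ P.K : ℕ) : ℝ) ^ (-γ) * (2 * (a * c₀))) * cr *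
              (nΩ * (2 / gam0L P.d a P.L) * cr * (nη * w * (a * c₀)))) *
          Real.exp (-(ρ * g.dist y y'))) := by
  obtain ⟨δ₀, c₀, hδ₀, hc₀, H⟩ := minimiser_decay_of_dominance dd L hd hL ha hm
  refine ⟨δ₀, c₀, hδ₀, hc₀, ?_⟩
  intro P hPd hPL hPK _ n hn M _ hMK g _ htri hdist hsymm σr cr hσr hrow blkΩ nΩ hnΩ blkη nη hnη pr hpr Hk hH Hk' hH'
    w hw0 K hK K' hK' δC hdom κ hκ hdomA hdomB ρ hρ hρ₁ hρ₂
  have hPd0 : 0 < P.d := by have := P.hd; omega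
  have hPodd : Odd P.L := P.hL.1
  have hPL2 : 2 ≤ P.L := by have := P.hL.2; omega
  obtain ⟨hdecA, hdecB⟩ := H P hPd hPL hPK n (fine P.L M) hMK blkΩ blkη pr hdist hκ hdomA hdomB
  exact hasMaj_idef_kingPiece_covFree hPd0 hPodd hPL2 hPK hn M ha hm hγ0 hγ1 htri hdist hsymm hσr hrow blkΩ hnΩ
    blkη hnη pr hpr Hk hH Hk' hH' hw0 K hK K' hK' (c₀ := a * c₀) (δ₀ := δ₀ * κ) (mul_nonneg ha.le hc₀.le)
    (fun b x => by rw [hH]; exact hdecA b x) (fun b x' => by rw [hH']; exact hdecB hn b x') hρ hdom hρ₁ hρ₂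

end Piece

end Summit.QuantumFields.YangMills.BalabanUVNodes.N15.DefectKernel
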